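import Summits.BirchSwinnertonDyer.BirchSwinnertonDyer.Theorems.ManinLocalTwoThreeNewformRowsThreeTwenty
import Summits.BirchSwinnertonDyer.BirchSwinnertonDyer.Theorems.ManinLocalTwoThreeTwistDefectRootLevel
import Summits.BirchSwinnertonDyer.BirchSwinnertonDyer.Theorems.ManinLocalTwoThreeRootFormsEightyNeron
import Summits.BirchSwinnertonDyer.BirchSwinnertonDyer.Theorems.ManinLocalTwoThreeRootFormFortyEven
import Summits.BirchSwinnertonDyer.BirchSwinnertonDyer.Theorems.Rank2ObservatoryKrausCert
import Summits.BirchSwinnertonDyer.Rank1Residual.Additive.IntModelTamagawaCertificate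
import HarnessLib

/-!
# `|c| = 1` on `X₀(320)` — UNCONDITIONALLY: LEVEL `320 = 2⁶·5` (conductor exponent SIX at `2`, six newform classes) of the crux C2's domain,
# by the ALIGNED TWO-TWIST TRANSPORT from the roots `40a`, `80b`, `160a`

Cell bsd-f2-manin, route `ManinLocalTwoThree` (crux C2 `ManinOddAtFour`, stmt-BirchSwinnertonDyer-22967; `--supports` helper), LEAD p1 gen 27.
Part 3 (capstone) of the LEVEL-320 chain: an g57's cusp-space kernel pinning (`…PinningThreeTwenty`, 7 files, landed by this seat) ⟶ the six
newform ROWS (part 2 `…NewformRowsThreeTwenty.cuspCoeff_f_cases`: `320a = φ₈₀ᵦ ⊗ χ₈`, `320b = φ₁₆₀ₐ ⊗ χ₈′`, `320c = φ₄₀ ⊗ χ₈`, `320d = φ₄₀ ⊗ χ₈′`,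
`320e = φ₁₆₀ₐ ⊗ χ₈`, `320f = φ₈₀ᵦ ⊗ χ₈′`, in an's `goodCerts` order) ⟶ the root packages (`φ₄₀`: LEAD g26 `…ManinConstantTwoHundredC` /
`…RootFormFortyEven` + p3's `EtaIdentitiesForty.periodLatticeLe_forty`; `φ₈₀ᵦ`: LEAD g26 `…RootFormsEighty` + `…RootFormsEightyNeron`; `φ₁₆₀ₐ`: part 1
`…RootFormOneSixty`, built on p2 g31's level-160 Bracket–Sturm certificate) ⟶ desc g46's THEOREM 71.I
`TwistDefect.abs_maninConstant_eq_one_of_squeeze_twoTwist_aligned_level` (two-twist `d = ±2`, root level `M ∈ {40, 80, 160}` with `4 ∣ M`, `M ∣ 320`,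
`8² ∣ 320`, ALIGNED minimal model `C` of `W₀ ⊗ d` with `Δ_C = d⁶ Δ_{W₀}`).

* §1 THE SIX ALIGNED EDGES (kernel arithmetic): the plain twist models `80b1 ⊗ 2 = [0,−2,0,16,−32]`, `160a1 ⊗ (−2) = [0,−2,0,−24,−32]`,
  `40a1 ⊗ 2 = [0,0,0,−28,−48]`, `40a1 ⊗ (−2) = [0,0,0,−28,48]`, `160a1 ⊗ 2 = [0,2,0,−24,32]`, `80b1 ⊗ (−2) = [0,2,0,16,32]` (`u = 1`, `r = 1`) are
  elliptic and GLOBALLY MINIMAL by KRAUS certificates at `2` (`v₂(Δ) ∈ {12, 14}`, `v₂(c₄) = 6`, `v₂(c₆ + 64) = 6`; the tree's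
  `Rank2Observatory.isGloballyMinimal_of_krausCheck`) — the minimal discriminant of every class of conductor `320` is `2⁶` times that of its root.
* §2 THE HEADLINE **`abs_maninConstant_eq_one_threeTwenty (W) [IsElliptic] [IsGloballyMinimal] (D : ModularParametrizationData W 320) (hopt) :
  |D.maninConstant| = 1`** — by cases on the row; hence `2 ∤ c` (C2's body at `N = 320` with NONE of the item's hypotheses), no prime divides `c`,
  and the item-shaped clause `maninOddAtFour_threeTwenty`.

HONEST FRAMING: unconditional (standard axioms); LEVEL 320 joins the complete levels (the second with `v₂(N) = 6`, after `192`).  The `∀ N` cruxes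
C2/C3, Manin's conjecture and BSD are NOT proved; item 22967 stays OPEN as filed.  No definition, no named fact, no sorry.
[cite: CremonaAlgorithms1997, §2.10, Table 1 (N = 320; 40a1, 80b1, 160a1)] [cite: Kraus1989, Prop. 2] [cite: Stevens1989, Lemma (5.4) p. 97]
[cite: Pal2012, Prop. 2.4, Lemma 3.1] [cite: AgasheRibetStein2006, §§1–2]
-/

set_option autoImplicit false
-- lint-debt: the directory name repeats the summit name (sibling precedent `ManinLocalTwoThreeManinConstantOneNinetyTwo.lean`)
set_option linter.dupNamespace false

noncomputable section

open WeierstrassCurve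
open scoped MatrixGroups ModularForm
open CongruenceSubgroup
open Literature.NumberTheory.EllipticCurves Literature.NumberTheory.EllipticCurves.ModularForms

namespace Summit.BirchSwinnertonDyer.BirchSwinnertonDyer.Theorems.ManinLocalTwoThree.LevelThreeTwenty

open Summit.BirchSwinnertonDyer.BirchSwinnertonDyer.Theorems.ManinLocalTwoThree
open Summit.BirchSwinnertonDyer.BirchSwinnertonDyer.Theorems
open Summit.BirchSwinnertonDyer.BirchSwinnertonDyer.Rank2Observatory
open Summit.BirchSwinnertonDyer.Rank1Residual.Additive
open TwistDefect PinningThreeTwenty LevelTwoHundred RootFormsEighty RootFormOneSixty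

/-! ## §1 The six aligned edges and their minimal models -/

/-- **ALIGNED EDGE `80b1 ⊗ (2) = [0, -2, 0, 16, -32]`** (the plain twist model, `u = 1`). [cite: CremonaAlgorithms1997, Table 1 (80b1, N = 320)] -/
theorem smul_quadraticTwist_eightyB1_two :
    (⟨1, 0, 0, 0⟩ : VariableChange ℚ) • (⟨0, -1, 0, 4, -4⟩ : WeierstrassCurve ℚ).quadraticTwist ((2 : ℤ) : ℚ) = ⟨0, -2, 0, 16, -32⟩ := by
  ext <;> simp only [variableChange_a₁, variableChange_a₂, variableChange_a₃, variableChange_a₄, variableChange_a₆,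
    quadraticTwist_a₁, quadraticTwist_a₂, quadraticTwist_a₃, quadraticTwist_a₄, quadraticTwist_a₆, b₂, b₄, b₆] <;> norm_num

/-- `Δ([0, -2, 0, 16, -32]) = (2)⁶·Δ(80b1)` (the edge is ALIGNED, `r = 1`). [folklore] -/
theorem Δ_rowA_eq : (((1 : ℤ)) : ℚ) ^ 12 * (⟨0, -2, 0, 16, -32⟩ : WeierstrassCurve ℚ).Δ = (((2 : ℤ)) : ℚ) ^ 6 * (⟨0, -1, 0, 4, -4⟩ : WeierstrassCurve ℚ).Δ := by
  norm_num [WeierstrassCurve.Δ, WeierstrassCurve.b₂, WeierstrassCurve.b₄, WeierstrassCurve.b₆, WeierstrassCurve.b₈]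

/-- `[0, -2, 0, 16, -32]` is an elliptic curve (`Δ = -409600`). [folklore] -/
theorem isElliptic_rowA : (⟨0, -2, 0, 16, -32⟩ : WeierstrassCurve ℚ).IsElliptic :=
  ⟨by norm_num [WeierstrassCurve.Δ, WeierstrassCurve.b₂, WeierstrassCurve.b₄, WeierstrassCurve.b₆, WeierstrassCurve.b₈]⟩

/-- **`[0, -2, 0, 16, -32]` is globally minimal** — KRAUS certificate at `2` (`|Δ| = 2^14·5^2`, `c₄ = -704` with `2⁸ ∤ c₄`, `2⁸ ∤ c₆ + 64 = 19008`),
Silverman at `5` (`5 ∤ c₄`). [cite: Kraus1989, Prop. 2] [cite: SilvermanAEC2009, VII.1 Remark 1.1] -/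
theorem isGloballyMinimal_rowA : (⟨0, -2, 0, 16, -32⟩ : WeierstrassCurve ℚ).IsGloballyMinimal := by
  rw [show (⟨0, -2, 0, 16, -32⟩ : WeierstrassCurve ℚ) = ⟨((0 : ℤ) : ℚ), ((-2 : ℤ) : ℚ), ((0 : ℤ) : ℚ), ((16 : ℤ) : ℚ), ((-32 : ℤ) : ℚ)⟩ by
    ext <;> norm_num, ← IntModelTam.baseChange_rat_mk_int]
  exact isGloballyMinimal_of_krausCheck (W₀ := ⟨0, -2, 0, 16, -32⟩) (c := ⟨14, 6, 9, [⟨5, 2, 2, 0, 0⟩]⟩) (by decide +kernel)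

/-- **ALIGNED EDGE `160a1 ⊗ (-2) = [0, -2, 0, -24, -32]`** (the plain twist model, `u = 1`). [cite: CremonaAlgorithms1997, Table 1 (160a1, N = 320)] -/
theorem smul_quadraticTwist_oneSixtyA1_negTwo :
    (⟨1, 0, 0, 0⟩ : VariableChange ℚ) • (⟨0, 1, 0, -6, 4⟩ : WeierstrassCurve ℚ).quadraticTwist ((-2 : ℤ) : ℚ) = ⟨0, -2, 0, -24, -32⟩ := by
  ext <;> simp only [variableChange_a₁, variableChange_a₂, variableChange_a₃, variableChange_a₄, variableChange_a₆,
    quadraticTwist_a₁, quadraticTwist_a₂, quadraticTwist_a₃, quadraticTwist_a₄, quadraticTwist_a₆, b₂, b₄, b₆] <;> norm_num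

/-- `Δ([0, -2, 0, -24, -32]) = (-2)⁶·Δ(160a1)` (the edge is ALIGNED, `r = 1`). [folklore] -/
theorem Δ_rowB_eq : (((1 : ℤ)) : ℚ) ^ 12 * (⟨0, -2, 0, -24, -32⟩ : WeierstrassCurve ℚ).Δ = (((-2 : ℤ)) : ℚ) ^ 6 * (⟨0, 1, 0, -6, 4⟩ : WeierstrassCurve ℚ).Δ := by
  norm_num [WeierstrassCurve.Δ, WeierstrassCurve.b₂, WeierstrassCurve.b₄, WeierstrassCurve.b₆, WeierstrassCurve.b₈]

/-- `[0, -2, 0, -24, -32]` is an elliptic curve (`Δ = 20480`). [folklore] -/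
theorem isElliptic_rowB : (⟨0, -2, 0, -24, -32⟩ : WeierstrassCurve ℚ).IsElliptic :=
  ⟨by norm_num [WeierstrassCurve.Δ, WeierstrassCurve.b₂, WeierstrassCurve.b₄, WeierstrassCurve.b₆, WeierstrassCurve.b₈]⟩

/-- **`[0, -2, 0, -24, -32]` is globally minimal** — KRAUS certificate at `2` (`|Δ| = 2^12·5^1`, `c₄ = 1216` with `2⁸ ∤ c₄`, `2⁸ ∤ c₆ + 64 = 42048`),
Silverman at `5` (`5 ∤ c₄`). [cite: Kraus1989, Prop. 2] [cite: SilvermanAEC2009, VII.1 Remark 1.1] -/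
theorem isGloballyMinimal_rowB : (⟨0, -2, 0, -24, -32⟩ : WeierstrassCurve ℚ).IsGloballyMinimal := by
  rw [show (⟨0, -2, 0, -24, -32⟩ : WeierstrassCurve ℚ) = ⟨((0 : ℤ) : ℚ), ((-2 : ℤ) : ℚ), ((0 : ℤ) : ℚ), ((-24 : ℤ) : ℚ), ((-32 : ℤ) : ℚ)⟩ by
    ext <;> norm_num, ← IntModelTam.baseChange_rat_mk_int]
  exact isGloballyMinimal_of_krausCheck (W₀ := ⟨0, -2, 0, -24, -32⟩) (c := ⟨12, 6, 10, [⟨5, 2, 1, 0, 0⟩]⟩) (by decide +kernel)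

/-- **ALIGNED EDGE `40a1 ⊗ (2) = [0, 0, 0, -28, -48]`** (the plain twist model, `u = 1`). [cite: CremonaAlgorithms1997, Table 1 (40a1, N = 320)] -/
theorem smul_quadraticTwist_fortyA1_two :
    (⟨1, 0, 0, 0⟩ : VariableChange ℚ) • (⟨0, 0, 0, -7, -6⟩ : WeierstrassCurve ℚ).quadraticTwist ((2 : ℤ) : ℚ) = ⟨0, 0, 0, -28, -48⟩ := by
  ext <;> simp only [variableChange_a₁, variableChange_a₂, variableChange_a₃, variableChange_a₄, variableChange_a₆,
    quadraticTwist_a₁, quadraticTwist_a₂, quadraticTwist_a₃, quadraticTwist_a₄, quadraticTwist_a₆, b₂, b₄, b₆] <;> norm_num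

/-- `Δ([0, 0, 0, -28, -48]) = (2)⁶·Δ(40a1)` (the edge is ALIGNED, `r = 1`). [folklore] -/
theorem Δ_rowC_eq : (((1 : ℤ)) : ℚ) ^ 12 * (⟨0, 0, 0, -28, -48⟩ : WeierstrassCurve ℚ).Δ = (((2 : ℤ)) : ℚ) ^ 6 * (⟨0, 0, 0, -7, -6⟩ : WeierstrassCurve ℚ).Δ := by
  norm_num [WeierstrassCurve.Δ, WeierstrassCurve.b₂, WeierstrassCurve.b₄, WeierstrassCurve.b₆, WeierstrassCurve.b₈]

/-- `[0, 0, 0, -28, -48]` is an elliptic curve (`Δ = 409600`). [folklore] -/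
theorem isElliptic_rowC : (⟨0, 0, 0, -28, -48⟩ : WeierstrassCurve ℚ).IsElliptic :=
  ⟨by norm_num [WeierstrassCurve.Δ, WeierstrassCurve.b₂, WeierstrassCurve.b₄, WeierstrassCurve.b₆, WeierstrassCurve.b₈]⟩

/-- **`[0, 0, 0, -28, -48]` is globally minimal** — KRAUS certificate at `2` (`|Δ| = 2^14·5^2`, `c₄ = 1344` with `2⁸ ∤ c₄`, `2⁸ ∤ c₆ + 64 = 41536`),
Silverman at `5` (`5 ∤ c₄`). [cite: Kraus1989, Prop. 2] [cite: SilvermanAEC2009, VII.1 Remark 1.1] -/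
theorem isGloballyMinimal_rowC : (⟨0, 0, 0, -28, -48⟩ : WeierstrassCurve ℚ).IsGloballyMinimal := by
  rw [show (⟨0, 0, 0, -28, -48⟩ : WeierstrassCurve ℚ) = ⟨((0 : ℤ) : ℚ), ((0 : ℤ) : ℚ), ((0 : ℤ) : ℚ), ((-28 : ℤ) : ℚ), ((-48 : ℤ) : ℚ)⟩ by
    ext <;> norm_num, ← IntModelTam.baseChange_rat_mk_int]
  exact isGloballyMinimal_of_krausCheck (W₀ := ⟨0, 0, 0, -28, -48⟩) (c := ⟨14, 6, 9, [⟨5, 2, 2, 0, 0⟩]⟩) (by decide +kernel)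

/-- **ALIGNED EDGE `40a1 ⊗ (-2) = [0, 0, 0, -28, 48]`** (the plain twist model, `u = 1`). [cite: CremonaAlgorithms1997, Table 1 (40a1, N = 320)] -/
theorem smul_quadraticTwist_fortyA1_negTwo :
    (⟨1, 0, 0, 0⟩ : VariableChange ℚ) • (⟨0, 0, 0, -7, -6⟩ : WeierstrassCurve ℚ).quadraticTwist ((-2 : ℤ) : ℚ) = ⟨0, 0, 0, -28, 48⟩ := by
  ext <;> simp only [variableChange_a₁, variableChange_a₂, variableChange_a₃, variableChange_a₄, variableChange_a₆,
    quadraticTwist_a₁, quadraticTwist_a₂, quadraticTwist_a₃, quadraticTwist_a₄, quadraticTwist_a₆, b₂, b₄, b₆] <;> norm_num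

/-- `Δ([0, 0, 0, -28, 48]) = (-2)⁶·Δ(40a1)` (the edge is ALIGNED, `r = 1`). [folklore] -/
theorem Δ_rowD_eq : (((1 : ℤ)) : ℚ) ^ 12 * (⟨0, 0, 0, -28, 48⟩ : WeierstrassCurve ℚ).Δ = (((-2 : ℤ)) : ℚ) ^ 6 * (⟨0, 0, 0, -7, -6⟩ : WeierstrassCurve ℚ).Δ := by
  norm_num [WeierstrassCurve.Δ, WeierstrassCurve.b₂, WeierstrassCurve.b₄, WeierstrassCurve.b₆, WeierstrassCurve.b₈]

/-- `[0, 0, 0, -28, 48]` is an elliptic curve (`Δ = 409600`). [folklore] -/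
theorem isElliptic_rowD : (⟨0, 0, 0, -28, 48⟩ : WeierstrassCurve ℚ).IsElliptic :=
  ⟨by norm_num [WeierstrassCurve.Δ, WeierstrassCurve.b₂, WeierstrassCurve.b₄, WeierstrassCurve.b₆, WeierstrassCurve.b₈]⟩

/-- **`[0, 0, 0, -28, 48]` is globally minimal** — KRAUS certificate at `2` (`|Δ| = 2^14·5^2`, `c₄ = 1344` with `2⁸ ∤ c₄`, `2⁸ ∤ c₆ + 64 = -41408`),
Silverman at `5` (`5 ∤ c₄`). [cite: Kraus1989, Prop. 2] [cite: SilvermanAEC2009, VII.1 Remark 1.1] -/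
theorem isGloballyMinimal_rowD : (⟨0, 0, 0, -28, 48⟩ : WeierstrassCurve ℚ).IsGloballyMinimal := by
  rw [show (⟨0, 0, 0, -28, 48⟩ : WeierstrassCurve ℚ) = ⟨((0 : ℤ) : ℚ), ((0 : ℤ) : ℚ), ((0 : ℤ) : ℚ), ((-28 : ℤ) : ℚ), ((48 : ℤ) : ℚ)⟩ by
    ext <;> norm_num, ← IntModelTam.baseChange_rat_mk_int]
  exact isGloballyMinimal_of_krausCheck (W₀ := ⟨0, 0, 0, -28, 48⟩) (c := ⟨14, 6, 9, [⟨5, 2, 2, 0, 0⟩]⟩) (by decide +kernel)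

/-- **ALIGNED EDGE `160a1 ⊗ (2) = [0, 2, 0, -24, 32]`** (the plain twist model, `u = 1`). [cite: CremonaAlgorithms1997, Table 1 (160a1, N = 320)] -/
theorem smul_quadraticTwist_oneSixtyA1_two :
    (⟨1, 0, 0, 0⟩ : VariableChange ℚ) • (⟨0, 1, 0, -6, 4⟩ : WeierstrassCurve ℚ).quadraticTwist ((2 : ℤ) : ℚ) = ⟨0, 2, 0, -24, 32⟩ := by
  ext <;> simp only [variableChange_a₁, variableChange_a₂, variableChange_a₃, variableChange_a₄, variableChange_a₆,
    quadraticTwist_a₁, quadraticTwist_a₂, quadraticTwist_a₃, quadraticTwist_a₄, quadraticTwist_a₆, b₂, b₄, b₆] <;> norm_num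

/-- `Δ([0, 2, 0, -24, 32]) = (2)⁶·Δ(160a1)` (the edge is ALIGNED, `r = 1`). [folklore] -/
theorem Δ_rowE_eq : (((1 : ℤ)) : ℚ) ^ 12 * (⟨0, 2, 0, -24, 32⟩ : WeierstrassCurve ℚ).Δ = (((2 : ℤ)) : ℚ) ^ 6 * (⟨0, 1, 0, -6, 4⟩ : WeierstrassCurve ℚ).Δ := by
  norm_num [WeierstrassCurve.Δ, WeierstrassCurve.b₂, WeierstrassCurve.b₄, WeierstrassCurve.b₆, WeierstrassCurve.b₈]

/-- `[0, 2, 0, -24, 32]` is an elliptic curve (`Δ = 20480`). [folklore] -/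
theorem isElliptic_rowE : (⟨0, 2, 0, -24, 32⟩ : WeierstrassCurve ℚ).IsElliptic :=
  ⟨by norm_num [WeierstrassCurve.Δ, WeierstrassCurve.b₂, WeierstrassCurve.b₄, WeierstrassCurve.b₆, WeierstrassCurve.b₈]⟩

/-- **`[0, 2, 0, -24, 32]` is globally minimal** — KRAUS certificate at `2` (`|Δ| = 2^12·5^1`, `c₄ = 1216` with `2⁸ ∤ c₄`, `2⁸ ∤ c₆ + 64 = -41920`),
Silverman at `5` (`5 ∤ c₄`). [cite: Kraus1989, Prop. 2] [cite: SilvermanAEC2009, VII.1 Remark 1.1] -/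
theorem isGloballyMinimal_rowE : (⟨0, 2, 0, -24, 32⟩ : WeierstrassCurve ℚ).IsGloballyMinimal := by
  rw [show (⟨0, 2, 0, -24, 32⟩ : WeierstrassCurve ℚ) = ⟨((0 : ℤ) : ℚ), ((2 : ℤ) : ℚ), ((0 : ℤ) : ℚ), ((-24 : ℤ) : ℚ), ((32 : ℤ) : ℚ)⟩ by
    ext <;> norm_num, ← IntModelTam.baseChange_rat_mk_int]
  exact isGloballyMinimal_of_krausCheck (W₀ := ⟨0, 2, 0, -24, 32⟩) (c := ⟨12, 6, 10, [⟨5, 2, 1, 0, 0⟩]⟩) (by decide +kernel)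

/-- **ALIGNED EDGE `80b1 ⊗ (-2) = [0, 2, 0, 16, 32]`** (the plain twist model, `u = 1`). [cite: CremonaAlgorithms1997, Table 1 (80b1, N = 320)] -/
theorem smul_quadraticTwist_eightyB1_negTwo :
    (⟨1, 0, 0, 0⟩ : VariableChange ℚ) • (⟨0, -1, 0, 4, -4⟩ : WeierstrassCurve ℚ).quadraticTwist ((-2 : ℤ) : ℚ) = ⟨0, 2, 0, 16, 32⟩ := by
  ext <;> simp only [variableChange_a₁, variableChange_a₂, variableChange_a₃, variableChange_a₄, variableChange_a₆,
    quadraticTwist_a₁, quadraticTwist_a₂, quadraticTwist_a₃, quadraticTwist_a₄, quadraticTwist_a₆, b₂, b₄, b₆] <;> norm_num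

/-- `Δ([0, 2, 0, 16, 32]) = (-2)⁶·Δ(80b1)` (the edge is ALIGNED, `r = 1`). [folklore] -/
theorem Δ_rowF_eq : (((1 : ℤ)) : ℚ) ^ 12 * (⟨0, 2, 0, 16, 32⟩ : WeierstrassCurve ℚ).Δ = (((-2 : ℤ)) : ℚ) ^ 6 * (⟨0, -1, 0, 4, -4⟩ : WeierstrassCurve ℚ).Δ := by
  norm_num [WeierstrassCurve.Δ, WeierstrassCurve.b₂, WeierstrassCurve.b₄, WeierstrassCurve.b₆, WeierstrassCurve.b₈]

/-- `[0, 2, 0, 16, 32]` is an elliptic curve (`Δ = -409600`). [folklore] -/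
theorem isElliptic_rowF : (⟨0, 2, 0, 16, 32⟩ : WeierstrassCurve ℚ).IsElliptic :=
  ⟨by norm_num [WeierstrassCurve.Δ, WeierstrassCurve.b₂, WeierstrassCurve.b₄, WeierstrassCurve.b₆, WeierstrassCurve.b₈]⟩

/-- **`[0, 2, 0, 16, 32]` is globally minimal** — KRAUS certificate at `2` (`|Δ| = 2^14·5^2`, `c₄ = -704` with `2⁸ ∤ c₄`, `2⁸ ∤ c₆ + 64 = -18880`),
Silverman at `5` (`5 ∤ c₄`). [cite: Kraus1989, Prop. 2] [cite: SilvermanAEC2009, VII.1 Remark 1.1] -/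
theorem isGloballyMinimal_rowF : (⟨0, 2, 0, 16, 32⟩ : WeierstrassCurve ℚ).IsGloballyMinimal := by
  rw [show (⟨0, 2, 0, 16, 32⟩ : WeierstrassCurve ℚ) = ⟨((0 : ℤ) : ℚ), ((2 : ℤ) : ℚ), ((0 : ℤ) : ℚ), ((16 : ℤ) : ℚ), ((32 : ℤ) : ℚ)⟩ by
    ext <;> norm_num, ← IntModelTam.baseChange_rat_mk_int]
  exact isGloballyMinimal_of_krausCheck (W₀ := ⟨0, 2, 0, 16, 32⟩) (c := ⟨14, 6, 9, [⟨5, 2, 2, 0, 0⟩]⟩) (by decide +kernel)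

/-! ## §2 The headline: `|c| = 1` on `X₀(320)`, unconditionally -/

/-- **LEVEL 320 COMPLETE — `|c| = 1` for every globally minimal elliptic `W/ℚ` and every `X₀(320)`-datum with the lattice clause
`Λ_W = c·Λ_f`.**  Rows `320c/320d` (`D.f = φ₄₀ ⊗ χ₈ / χ₈′`): root squeeze `Λ(φ₄₀) ⊆ Λ_Néron(40a1)`; rows `320a/320f` (`D.f = φ₈₀ᵦ ⊗ χ₈ / χ₈′`):
`Λ(φ₈₀ᵦ) ⊆ Λ_Néron(80b1)`; rows `320e/320b` (`D.f = φ₁₆₀ₐ ⊗ χ₈ / χ₈′`): `Λ(φ₁₆₀ₐ) ⊆ Λ_Néron(160a1)`; each closed by desc's two-twist aligned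
transport (Stevens (5.4) twisting on `Γ₀`, the half-translate `heven`, Pal's Néron-lattice twist identity, p3's Néron squeeze).  No modularity,
no CDT, no printed Manin fact, no root datum. [cite: Stevens1989, Lemma (5.4) p. 97] [cite: Pal2012, Prop. 2.4, Lemma 3.1]
[cite: AgasheRibetStein2006, §§1–2] [cite: CremonaAlgorithms1997, Table 1 (N = 320)] -/
theorem abs_maninConstant_eq_one_threeTwenty (W : WeierstrassCurve ℚ) [W.IsElliptic] [W.IsGloballyMinimal]
    (D : ModularParametrizationData W 320) (hopt : ∀ z ∈ D.L.lattice, ∃ w ∈ periodLattice D.f, z = D.c * w) :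
    |D.maninConstant| = 1 := by
  -- the three roots
  obtain ⟨L₄₀, hg2, hg3, hle40⟩ := EtaIdentitiesForty.periodLatticeLe_forty phiForty coe_phiForty
  have hL40 := (EtaIdentitiesForty.isNeronLatticeOf_fortyA1_iff L₄₀).mpr ⟨hg2, hg3⟩
  haveI := EtaIdentitiesForty.isElliptic_fortyA1
  obtain ⟨L₈₀, hL80, hle80⟩ := exists_neron_squeeze_phiEightyB
  haveI := AddPotGoodPrint.isElliptic_80b1
  obtain ⟨L₁₆₀, hL160, hle160⟩ := exists_neron_squeeze_phiOneSixtyA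
  haveI := LevelOneSixty.isElliptic_oneSixtyA1
  -- the six aligned minimal models
  haveI := isElliptic_rowA; haveI := isElliptic_rowB; haveI := isElliptic_rowC
  haveI := isElliptic_rowD; haveI := isElliptic_rowE; haveI := isElliptic_rowF
  haveI := isGloballyMinimal_rowA; haveI := isGloballyMinimal_rowB; haveI := isGloballyMinimal_rowC
  haveI := isGloballyMinimal_rowD; haveI := isGloballyMinimal_rowE; haveI := isGloballyMinimal_rowF
  have h4_40 : 4 ∣ 40 := ⟨10, by norm_num⟩
  have h4_80 : 4 ∣ 80 := ⟨20, by norm_num⟩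
  have h4_160 : 4 ∣ 160 := ⟨40, by norm_num⟩
  have h40 : 40 ∣ 320 := ⟨8, by norm_num⟩
  have h80 : 80 ∣ 320 := ⟨4, by norm_num⟩
  have h160 : 160 ∣ 320 := ⟨2, by norm_num⟩
  have h64 : 8 ^ 2 ∣ 320 := ⟨5, by norm_num⟩
  rcases cuspCoeff_f_cases D with ⟨-, hf⟩ | ⟨-, hf⟩ | ⟨-, hf⟩ | ⟨-, hf⟩ | ⟨-, hf⟩ | ⟨-, hf⟩
  · -- 320a = 80b ⊗ χ₈ (d = 2), C = [0, -2, 0, 16, -32]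
    exact abs_maninConstant_eq_one_of_squeeze_twoTwist_aligned_level (d := 2) (Or.inl rfl) h4_80 h80 h64 phiEightyB
      (⟨0, -1, 0, 4, -4⟩ : WeierstrassCurve ℚ) L₈₀ hL80 hle80 cuspCoeff_even_phiEightyB (C := ⟨0, -2, 0, 16, -32⟩) ⟨1, 0, 0, 0⟩
      smul_quadraticTwist_eightyB1_two (r := 1) (Or.inl rfl) Δ_rowA_eq W D
      (fun n _ ↦ by rw [if_pos rfl]; exact hf n) hopt
  · -- 320b = 160a ⊗ χ₈′ (d = -2), C = [0, -2, 0, -24, -32]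
    exact abs_maninConstant_eq_one_of_squeeze_twoTwist_aligned_level (d := -2) (Or.inr rfl) h4_160 h160 h64 phiOneSixtyA
      (⟨0, 1, 0, -6, 4⟩ : WeierstrassCurve ℚ) L₁₆₀ hL160 hle160 cuspCoeff_even_phiOneSixtyA (C := ⟨0, -2, 0, -24, -32⟩) ⟨1, 0, 0, 0⟩
      smul_quadraticTwist_oneSixtyA1_negTwo (r := 1) (Or.inl rfl) Δ_rowB_eq W D
      (fun n _ ↦ by rw [if_neg (by norm_num)]; exact hf n) hopt
  · -- 320c = 40a ⊗ χ₈ (d = 2), C = [0, 0, 0, -28, -48]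
    exact abs_maninConstant_eq_one_of_squeeze_twoTwist_aligned_level (d := 2) (Or.inl rfl) h4_40 h40 h64 phiForty
      (⟨0, 0, 0, -7, -6⟩ : WeierstrassCurve ℚ) L₄₀ hL40 hle40 cuspCoeff_even_phiForty (C := ⟨0, 0, 0, -28, -48⟩) ⟨1, 0, 0, 0⟩
      smul_quadraticTwist_fortyA1_two (r := 1) (Or.inl rfl) Δ_rowC_eq W D
      (fun n _ ↦ by rw [if_pos rfl]; exact hf n) hopt
  · -- 320d = 40a ⊗ χ₈′ (d = -2), C = [0, 0, 0, -28, 48]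
    exact abs_maninConstant_eq_one_of_squeeze_twoTwist_aligned_level (d := -2) (Or.inr rfl) h4_40 h40 h64 phiForty
      (⟨0, 0, 0, -7, -6⟩ : WeierstrassCurve ℚ) L₄₀ hL40 hle40 cuspCoeff_even_phiForty (C := ⟨0, 0, 0, -28, 48⟩) ⟨1, 0, 0, 0⟩
      smul_quadraticTwist_fortyA1_negTwo (r := 1) (Or.inl rfl) Δ_rowD_eq W D
      (fun n _ ↦ by rw [if_neg (by norm_num)]; exact hf n) hopt
  · -- 320e = 160a ⊗ χ₈ (d = 2), C = [0, 2, 0, -24, 32]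
    exact abs_maninConstant_eq_one_of_squeeze_twoTwist_aligned_level (d := 2) (Or.inl rfl) h4_160 h160 h64 phiOneSixtyA
      (⟨0, 1, 0, -6, 4⟩ : WeierstrassCurve ℚ) L₁₆₀ hL160 hle160 cuspCoeff_even_phiOneSixtyA (C := ⟨0, 2, 0, -24, 32⟩) ⟨1, 0, 0, 0⟩
      smul_quadraticTwist_oneSixtyA1_two (r := 1) (Or.inl rfl) Δ_rowE_eq W D
      (fun n _ ↦ by rw [if_pos rfl]; exact hf n) hopt
  · -- 320f = 80b ⊗ χ₈′ (d = -2), C = [0, 2, 0, 16, 32]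
    exact abs_maninConstant_eq_one_of_squeeze_twoTwist_aligned_level (d := -2) (Or.inr rfl) h4_80 h80 h64 phiEightyB
      (⟨0, -1, 0, 4, -4⟩ : WeierstrassCurve ℚ) L₈₀ hL80 hle80 cuspCoeff_even_phiEightyB (C := ⟨0, 2, 0, 16, 32⟩) ⟨1, 0, 0, 0⟩
      smul_quadraticTwist_eightyB1_negTwo (r := 1) (Or.inl rfl) Δ_rowF_eq W D
      (fun n _ ↦ by rw [if_neg (by norm_num)]; exact hf n) hopt

/-- **Corollary: no integer `q` with `|q| ≠ 1` — in particular neither `2` nor `5` nor any prime — divides the Manin constant of a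
lattice-optimal `X₀(320)`-datum.** [folklore] -/
theorem not_dvd_maninConstant_threeTwenty (W : WeierstrassCurve ℚ) [W.IsElliptic] [W.IsGloballyMinimal]
    (D : ModularParametrizationData W 320) (hopt : ∀ z ∈ D.L.lattice, ∃ w ∈ periodLattice D.f, z = D.c * w)
    {q : ℤ} (hq : q.natAbs ≠ 1) : ¬ q ∣ D.maninConstant := by
  intro h
  have h1 := abs_maninConstant_eq_one_threeTwenty W D hopt
  have hn : D.maninConstant.natAbs = 1 := by
    rw [Int.abs_eq_natAbs] at h1
    exact_mod_cast h1
  have h2 : q.natAbs ∣ 1 := hn ▸ Int.natAbs_dvd_natAbs.mpr h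
  exact hq (Nat.dvd_one.mp h2)

/-- **`2 ∤ c` on `X₀(320)`, UNCONDITIONALLY** — the body of the crux C2 `ManinOddAtFour` at `N = 320` (`2² ∣ 320`) with none of its
fact hypotheses. [cite: AgasheRibetStein2006, §§1–2] -/
theorem not_two_dvd_maninConstant_threeTwenty (W : WeierstrassCurve ℚ) [W.IsElliptic] [W.IsGloballyMinimal]
    (D : ModularParametrizationData W 320) (hopt : ∀ z ∈ D.L.lattice, ∃ w ∈ periodLattice D.f, z = D.c * w) :
    ¬ (2 : ℤ) ∣ D.maninConstant :=
  not_dvd_maninConstant_threeTwenty W D hopt (by decide)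

/-- **C2's inner clause at `N = 320` in the item's literal shape**: `2² ∣ 320`, and every lattice-optimal `X₀(320)`-datum of every
globally minimal elliptic curve has `|c| = 1` and `2 ∤ c`. [cite: CremonaAlgorithms1997, Table 1 (N = 320)] -/
theorem maninOddAtFour_threeTwenty : 2 ^ 2 ∣ 320 ∧
    ∀ (W : WeierstrassCurve ℚ) [W.IsElliptic] [W.IsGloballyMinimal] (D : ModularParametrizationData W 320),
      (∀ z ∈ D.L.lattice, ∃ w ∈ periodLattice D.f, z = D.c * w) →
        |D.maninConstant| = 1 ∧ ¬ (2 : ℤ) ∣ D.maninConstant :=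
  ⟨by norm_num, fun W _ _ D hopt ↦
    ⟨abs_maninConstant_eq_one_threeTwenty W D hopt, not_two_dvd_maninConstant_threeTwenty W D hopt⟩⟩

end Summit.BirchSwinnertonDyer.BirchSwinnertonDyer.Theorems.ManinLocalTwoThree.LevelThreeTwenty

end
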